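import Summits.QuantumFields.YangMills.Theorems.BalabanUVNodesN17AtRecord11Beta
import Literature.MathematicalPhysics.QuantumFieldTheory.Balaban1983to89.Node00.Record12

/-!
# BalabanUVNodes ∕ node N17 = NE4 AT NODE 00's STAGE-12 RECORD `Node00.IsRecordOfRecord₁₂C` (def-T `Node00/Record12.lean` v2.1, p458710 ∕ p459432): the
# Stage-12 datum carries the SAME continuous-version β of record as Stage 11 (`βfun_datumOfRecord₁₂ = betaOfRecord₁₀ θ.toStage9Params`, `rfl`) — every N17
# face of companion 9 re-keys `11 ↦ 12` BY `rfl`, and at Stage 12 the ∀-forms are NOT vacuous: `Provisos₁₂` dropped 11d's uninhabitable field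

Cell `pub-ymgap`, HUMAN RULING D-0062, seat `pub-ymgap-dag-n17-c` (R134 fan-out, strategy s2 = BY-NAME KNIT AT THE RECORD), generation 3; companion 13 (§43–§45)
of `BalabanUVNodesN17Knit` … `…N17AtRecord11` (p450153) ∕ `…N17AtRecord11Beta` (p457220).  THEOREMS ONLY; imports companion 10 `…N17AtRecord11Beta` (hence
companions 4–9 and module 2's `N17At ∕ S_N17 ∕ U3Carriers ∕ RateCarriers ∕ RateRecordPred ∕ ReadOutAt`) and def-T's `Node00/Record12` (`Stage12Params`,
`.Admissible F N` with `.toStage9`, `.Provisos₁₂ F N` with `.base ∕ .hasContTransportAlong`, `datumOfRecord₁₂`, `βfun_datumOfRecord₁₂`, `IsRecordOfRecord₁₂C`,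
`exists_world_isRecordOfRecord₁₂C`, `exists_isRecordOfRecord₅C_of_isRecordOfRecord₁₂C`); modifies nothing; every cited lemma used BY NAME; only the NAMED
projections of `Provisos₁₂` are used (`h.base`, `h.hasContTransportAlong`), never a positional destructuring (def-T v2.1 added the field `ztLocal`).

WHY A STAGE-12 TWIN (director-ym LINE №81 (3) ∕ №93; dag-lead WORDS-104 (A)(iii)).  def-T's kernel theorems `Node00.not_provisos₁₁` ∕ `not_isRecordOfRecord₁₁C`
(Record12 §4): 11d's `Provisos₁₁.alphaPos` reads `0 < 0` at the run `⟨0, 0, 0⟩`, so `IsRecordOfRecord₁₁C` is EMPTY and every Stage-11 face of companions 9–12 that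
takes `(h : θ.Provisos₁₁)` ∕ `IsRecordOfRecord₁₁C … D w` ∕ `IsDatumOfRecord₁₁C` is VACUOUS (it elaborates and stays).  Stage 12 DROPS that field (radii positivity is a
theorem in the window, `alphaPos₁₂_of_window`) and window-guards `bg`; no field of `Provisos₁₂` is kernel-unsatisfiable (ref-H ∕ ref-D DIFF-SWEEP (S11)), so the
∀-forms below have content exactly when K0′ `Record12Inhabited` holds (NOT claimed here).

THE POINT.  `IsRecordOfRecord₁₂C F N D w := ∃ (θ : Stage12Params F N) (h : θ.Provisos₁₂ F N), θ.Admissible F N ∧ D = datumOfRecord₁₂ F N θ h ∧ w.C = D.C ∧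
(0 < w.γ ∧ w.γ ≤ θ.γ) ∧ …` (Record12 §6).  The Stage-12 datum is a TOWER datum whose β-functions ARE `betaOfRecord₁₀ F N θ.toStage9Params` (`βfun_datumOfRecord₁₂`,
`rfl`) `= betaOfRecord₉c = betaOfRecord₈T (TcOfRecord) θ₈`, i.e. by `rfl` the definer's assembly line `betaOfMerged βmT (beta0OfMerged βmT θ.v₀) θ.γ`,
`βmT := betaMerged F (mergedTermFamilyMatT F N (TcOfRecord F N) (chiFixed7 F N θ.ν) θ.εbg) θ.ρ8 θ.bV` (§43 `βfun_datumOfRecord₁₂_eq_mergedT`) — THE SAME TERM AS AT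
STAGE 11 (the Stage-12 repairs re-pin the 𝐓-weights, the §2 [III] format clause and the level-0 background: `dens ∕ R ∕ Sect2Form`, never β).  N17 reads the datum
ONLY through `βfun` (companion 6 `YMDAG.N17.n17At_congr_βfun`), so:
* §43 AT THE STAGE-12 DATUM: `βfun_datumOfRecord₁₂_eq_mergedT` (`rfl`), `N17_datumOfRecord₁₂_iff_betaOfRecord₁₀` (ANY box side, `Iff.rfl` at def-T's face),
  `N17_datumOfRecord₁₂_iff_stage10` (N17 at the Stage-12 datum = at the Stage-10 datum of `θ.toStage9Params`, `h.base`), **`N17_datumOfRecord₁₂_iff_merged`**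
  (box `γ' ≤ θ.γ`: ↔ the η-rate of `βmT`), `u2Inputs_datumOfRecord₁₂_iff`, `n17At_datumOfRecord₁₂_iff_merged` (K4's letters), `N17_datumOfRecord₁₂_of_rates` (THE
  SPLIT ROAD: (AF-0r) for `beta0OfMerged βmT θ.v₀` — N15 = NE2's currency — ∧ the merged remainder's rate — N16 = NE3 ∕ N18 = NE5), `content_of_N17_datumOfRecord₁₂`,
  `N17_datumOfRecord₁₂_of_kernelStepRate` (KERNEL CURRENCY: (UD) ∧ the history-matched step rate of the record's OWN `Node00.polLimit` kernels),
  `N17_datumOfRecord₁₂_iff_of_lt` (the box CAP as an `iff`).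
* §44 AT THE RECORD PREDICATE ₁₂C: **`N17_of_isRecordOfRecord₁₂C`** (the `βmT` rate on the world's window asked of every admissible Stage-12 θ WITH ITS PROVISOS
  realising `D`), **`N17_iff_forall_of_isRecordOfRecord₁₂C`** (NEW: at a ₁₂C record that ∀-form hypothesis is also NECESSARY — no information is lost by the
  θ-keyed binder), `N17_of_isRecordOfRecord₁₂C_rates`, `N17_of_isRecordOfRecord₁₂C_kernelStepRate`, `u2Inputs_of_isRecordOfRecord₁₂C` (the N17 → N27 edge's
  input), **`exists_chart_scaleShiftRate_of_N17₁₂`** (`2 ≤ N`: a genuine chart `ρ8 ≠ 0` AND `HasContTransportAlong` at the witness), `af0r_of_N17_isRecordOfRecord₁₂C`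
  (what N17 DELIVERS: (AF-0r) for the record's one-loop numbers), `exists_shadow₅_N17_iff₁₂`, `exists_isRecordOfRecord₁₂C_N17_iff` (NEW, non-vacuity shape: every
  admissible θ with provisos IS a ₁₂C record at a world with any window `0 < γw ≤ θ.γ`, at which N17 ↔ the `βmT` rate — def-T's `exists_world_isRecordOfRecord₁₂C`).
* §45 THE K4 LINK AT ₁₂: **`s_N17_of_stage12_slot`**, `s_N17_of_rec₁₂C` (one-application closers of `YMDAG.UVSplit.S_N17 RRec` for ANY rate-record home whose bundles
  come with a Stage-12 witness ∕ a ₁₂C world — the shape RR-2's `Record12DatumKey` and the (T-RATE) `RRec₁₂` home will have), `readOutAt_datumOfRecord₁₂_iff_stage10`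
  (the U3 road: companion 6's stage-free `YMDAG.N17.s_N17_of_D4_N18` applies verbatim at `D := datumOfRecord₁₂ F N θ h`).
The β-face at def-B's names (read at the Stage-11 VIEW `θ.toStage11 F N p`, `rfl`) and the N17 → K2′ supplier `EndpointExistence (datumOfRecord₁₂ θ h).C.toB12` are
companion 14 (`…N17AtRecord12Beta`); the keyed ∕ home faces wait for `IsDatumOfRecord₁₂C` ∕ `RRec₁₂` (RR-2 ∕ (T-RATE) at ₁₂) — not typed before those names exist.
NO INHABITANT of `IsRecordOfRecord₁₂C` is claimed (that is K0′); `IsRecordOfRecord₁₂C → …₁₁C ∕ ₁₀C` does NOT hold at the datum (Record12's note; ₁₁C is even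
empty) — N17 needs only `βfun` equality, which holds with the ₁₀ datum (`rfl`) and with the ₅C shadow.

HONEST FRAMING.  Kernel bookkeeping BY NAME; 0 sorry; NE4 NOT IN PRINT ([Balaban1987RG1] (1.20)–(1.22) p. 264, p. 298) and NOT PROVED; every rate input a
displayed HYPOTHESIS (rows NE2 ∕ NE3 ∕ NE5 = N15 ∕ N16 ∕ N18 and (D4) through (1.22); (UD) = (5.10) p. 293 printed for Bałaban's kernels, a hypothesis here;
(AF-0r) = GAPS G-an2-4); the Stage-12 provisos are never assumed except as the record predicate's own conjunct; nothing of Bałaban's asserted; N17 = composite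
(max of N15, N16, (D4)), NOT discharged; «A: n∕28» unmoved.  One finite four-torus at fixed ε per run — NOT infinite volume, NOT OS on ℝ⁴, NOT a mass gap, NOT Clay.
-/

noncomputable section

open scoped Matrix.Norms.L2Operator

namespace Summit.QuantumFields.YangMills.Theorems.BalabanUVNodesN17

open Literature.MathematicalPhysics.QuantumFieldTheory.Balaban1983to89
open Literature.MathematicalPhysics.QuantumFieldTheory.Balaban1983to89.FlowStep
open Literature.MathematicalPhysics.QuantumFieldTheory.Balaban1983to89.T4CouplingMatching
open Literature.MathematicalPhysics.QuantumFieldTheory.Balaban1983to89.T4Continuum (T4Family FiniteEpsData ULoop)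
open Literature.MathematicalPhysics.QuantumFieldTheory.Balaban1983to89.B12Sec2to5 (Decay510 betaPrime510)
open Literature.MathematicalPhysics.QuantumFieldTheory.Balaban1983to89.Beta.LimitRate (subKernel)
open Literature.MathematicalPhysics.QuantumFieldTheory.Balaban1983to89.Node00
open Literature.MathematicalPhysics.QuantumFieldTheory.Balaban1983to89.DagBinding (WorldP)
open Summit.QuantumFields.BalabanUV.T4Continuum.Spine.NE4 (NE4OnData U2Inputs ne4OnData_iff)
open YMDAG.UVSplit (Datum U3Carriers RateCarriers RateRecordPred N17At S_N17)

variable {F : T4Family} {N : ℕ} [NeZero N]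

/-! ## §43 N17 AT THE STAGE-12 DATUM `datumOfRecord₁₂ F N θ h` — `βfun` IS the `(TcOfRecord, chiFixed7)` assembly line (`rfl`), as at Stage 11 -/

/-- **THE STAGE-12 DATUM's β-FUNCTIONS ARE THE DEFINER's ASSEMBLY LINE OVER THE CONTINUOUS-VERSION TRANSPORT** (`rfl` through `βfun_datumOfRecord₁₂`,
`betaOfRecord₁₀`, `betaOfRecord₉c_eq`, `betaOfRecord₈T`): `βfun = betaOfMerged βmT (beta0OfMerged βmT θ.v₀) θ.γ` with
`βmT = betaMerged F (mergedTermFamilyMatT F N (TcOfRecord F N) (chiFixed7 F N θ.ν) θ.εbg) θ.ρ8 θ.bV`. [cite: Balaban1987RG1, (1.20)-(1.22) p.264] -/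
theorem βfun_datumOfRecord₁₂_eq_mergedT (θ : Stage12Params F N) (h : θ.Provisos₁₂ F N) :
    (datumOfRecord₁₂ F N θ h).βfun =
      letI := θ.instVβ₁; letI := θ.instVβ₂; letI := θ.instιβ
      betaOfMerged (betaMerged F (mergedTermFamilyMatT F N (TcOfRecord F N) (chiFixed7 F N θ.ν) θ.εbg) θ.ρ8 θ.bV)
        (beta0OfMerged (betaMerged F (mergedTermFamilyMatT F N (TcOfRecord F N) (chiFixed7 F N θ.ν) θ.εbg) θ.ρ8 θ.bV) θ.v₀) θ.γ := rfl

/-- **N17 AT THE STAGE-12 DATUM IS THE SCALE-SHIFT RATE OF def-T's β OF RECORD `betaOfRecord₁₀ θ.toStage9Params`** — on EVERY box side `γ'` (no cap: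
`NE4OnData D := ScaleShiftRate … D.βfun`, `βfun_datumOfRecord₁₂`; `Iff.rfl`). [cite: Balaban1987RG1, (1.20)-(1.22) p.264] -/
theorem N17_datumOfRecord₁₂_iff_betaOfRecord₁₀ (θ : Stage12Params F N) (h : θ.Provisos₁₂ F N) (c ρ γ' : ℝ) :
    NE4OnData (datumOfRecord₁₂ F N θ h) c ρ γ' ↔ ScaleShiftRate c ρ γ' (betaOfRecord₁₀ F N θ.toStage9Params) := Iff.rfl

/-- **N17 AT THE STAGE-12 DATUM IS N17 AT THE STAGE-10 DATUM OF ITS STAGE-9 PART** [bookkeeping] (`h.base : θ.toStage9Params.Provisos₁₀`; both `βfun` are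
`betaOfRecord₁₀ θ.toStage9Params`, `rfl`) — on every box, with every constant and rate. [cite: Balaban1987RG1, (1.20)-(1.22) p.264] -/
theorem N17_datumOfRecord₁₂_iff_stage10 (θ : Stage12Params F N) (h : θ.Provisos₁₂ F N) (c ρ γ' : ℝ) :
    NE4OnData (datumOfRecord₁₂ F N θ h) c ρ γ' ↔ NE4OnData (datumOfRecord₁₀ F N θ.toStage9Params h.base) c ρ γ' := Iff.rfl

/-- **N17 AT THE STAGE-12 DATUM READS THE CONTINUOUS-VERSION MERGED β** on every box side `γ' ≤ θ.γ`:
`NE4OnData (datumOfRecord₁₂ F N θ h) c ρ γ' ↔ ScaleShiftRate c ρ γ' βmT` (companion 4 `N17_atRecord_iff_merged` at `βfun_datumOfRecord₁₂_eq_mergedT`).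
[cite: Balaban1987RG1, (1.20)-(1.22) p.264] -/
theorem N17_datumOfRecord₁₂_iff_merged (θ : Stage12Params F N) (h : θ.Provisos₁₂ F N) {c ρ γ' : ℝ} (hγ : γ' ≤ θ.γ) :
    NE4OnData (datumOfRecord₁₂ F N θ h) c ρ γ' ↔
      letI := θ.instVβ₁; letI := θ.instVβ₂; letI := θ.instιβ
      ScaleShiftRate c ρ γ'
        (betaMerged F (mergedTermFamilyMatT F N (TcOfRecord F N) (chiFixed7 F N θ.ν) θ.εbg) θ.ρ8 θ.bV) :=
  N17_atRecord_iff_merged _ (βfun_datumOfRecord₁₂_eq_mergedT θ h) hγ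

/-- **NODE U2's INPUT TRIPLE AT THE STAGE-12 DATUM** (box `γ' ≤ θ.γ`): `U2Inputs D₁₂ c C ρ γ' Λ ↔` the `βmT` rate ∧ its history moduli ∧ the β-free
fading-memory clause (companion 4 `u2Inputs_atRecord_iff`). [cite: Balaban1987RG1, §5 p.298] -/
theorem u2Inputs_datumOfRecord₁₂_iff (θ : Stage12Params F N) (h : θ.Provisos₁₂ F N) {c C ρ γ' : ℝ} {Λ : ℕ → ℕ → ℝ} (hγ : γ' ≤ θ.γ) :
    U2Inputs (datumOfRecord₁₂ F N θ h) c C ρ γ' Λ ↔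
      letI := θ.instVβ₁; letI := θ.instVβ₂; letI := θ.instιβ
      ScaleShiftRate c ρ γ' (betaMerged F (mergedTermFamilyMatT F N (TcOfRecord F N) (chiFixed7 F N θ.ν) θ.εbg) θ.ρ8 θ.bV) ∧
        HistLipschitz Λ γ' (betaMerged F (mergedTermFamilyMatT F N (TcOfRecord F N) (chiFixed7 F N θ.ν) θ.εbg) θ.ρ8 θ.bV) ∧
        FadingMemory C ρ Λ :=
  u2Inputs_atRecord_iff _ (βfun_datumOfRecord₁₂_eq_mergedT θ h) hγ

/-- **… IN CLUSTER K4's LETTERS** [bookkeeping]: for node U3's carriers `u` with `u.γ ≤ θ.γ`, `N17At (datumOfRecord₁₂ F N θ h) u ↔` the `βmT` rate at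
the dependent letters `(u.cr·u.C₅·u.θ, u.ρ, u.γ)`. [cite: Balaban1987RG1, (1.20)-(1.22) p.264] -/
theorem n17At_datumOfRecord₁₂_iff_merged (θ : Stage12Params F N) (h : θ.Provisos₁₂ F N) (u : U3Carriers) (hγ : u.γ ≤ θ.γ) :
    N17At (datumOfRecord₁₂ F N θ h) u ↔
      letI := θ.instVβ₁; letI := θ.instVβ₂; letI := θ.instιβ
      ScaleShiftRate (u.cr * u.C₅ * u.θ) u.ρ u.γ
        (betaMerged F (mergedTermFamilyMatT F N (TcOfRecord F N) (chiFixed7 F N θ.ν) θ.εbg) θ.ρ8 θ.bV) :=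
  N17_datumOfRecord₁₂_iff_merged θ h hγ

/-- **THE SPLIT ROAD AT THE STAGE-12 DATUM** («β⁰ conv + β¹ shift», companion 4 §14): (AF-0r) `|β⁰_{k+1} − β⁰_∞| ≤ c₀ρ^k` for the record's NAMED one-loop
number `β⁰ := beta0OfMerged βmT θ.v₀` (N15 = NE2's currency, GAPS G-an2-4) ∧ `ScaleShiftRate c₁ ρ γ' (βmT − β⁰)` for the merged remainder (N16 = NE3 ∕ N18 = NE5),
`γ' ≤ θ.γ`, `0 ≤ ρ ≤ 1`, `0 ≤ c₀` ⟹ `NE4OnData D₁₂ (2c₀ + c₁) ρ γ'`.  Both binders UNPRINTED. [cite: Balaban1987RG1, (2.12)-(2.14) p.268] -/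
theorem N17_datumOfRecord₁₂_of_rates (θ : Stage12Params F N) (h : θ.Provisos₁₂ F N) {binf c₀ c₁ ρ γ' : ℝ} (hγ : γ' ≤ θ.γ) (hρ0 : 0 ≤ ρ)
    (hρ1 : ρ ≤ 1) (hc₀ : 0 ≤ c₀)
    (hconv : letI := θ.instVβ₁; letI := θ.instVβ₂; letI := θ.instιβ
      ∀ k, |beta0OfMerged (betaMerged F (mergedTermFamilyMatT F N (TcOfRecord F N) (chiFixed7 F N θ.ν) θ.εbg) θ.ρ8 θ.bV) θ.v₀ k - binf| ≤
        c₀ * ρ ^ k)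
    (hrem : letI := θ.instVβ₁; letI := θ.instVβ₂; letI := θ.instιβ
      ScaleShiftRate c₁ ρ γ' fun k w =>
        betaMerged F (mergedTermFamilyMatT F N (TcOfRecord F N) (chiFixed7 F N θ.ν) θ.εbg) θ.ρ8 θ.bV k w -
          beta0OfMerged (betaMerged F (mergedTermFamilyMatT F N (TcOfRecord F N) (chiFixed7 F N θ.ν) θ.εbg) θ.ρ8 θ.bV) θ.v₀ k) :
    NE4OnData (datumOfRecord₁₂ F N θ h) (2 * c₀ + c₁) ρ γ' :=
  N17_atRecord_of_rates _ (βfun_datumOfRecord₁₂_eq_mergedT θ h) hγ hρ0 hρ1 hc₀ hconv hrem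

/-- **WHAT N17 DELIVERS AT THE STAGE-12 DATUM.**  On a box side `0 < γ' ≤ θ.γ` with `0 ≤ ρ < 1`: if the definer's one-sided limit `Beta0LimitExists βmT θ.v₀`
holds at COHERENT reference histories with entries in `]0,γ']`, then `NE4OnData D₁₂ c ρ γ'` ALONE yields (AF-0r) `∃ β⁰_∞, |β⁰_{k+1} − β⁰_∞| ≤ (c∕(1−ρ))ρ^k` for
the record's one-loop number `beta0OfMerged βmT θ.v₀` AND the merged remainder's rate (companion 4 `atRecord_content_of_scaleShiftRate_merged`).
[cite: Balaban1987RG1, (2.12)-(2.14) p.268] -/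
theorem content_of_N17_datumOfRecord₁₂ (θ : Stage12Params F N) (h : θ.Provisos₁₂ F N) {c ρ γ' : ℝ} (hγ : γ' ≤ θ.γ) (hγ' : 0 < γ')
    (hρ0 : 0 ≤ ρ) (hρ1 : ρ < 1)
    (hlim : letI := θ.instVβ₁; letI := θ.instVβ₂; letI := θ.instιβ
      Beta0LimitExists (betaMerged F (mergedTermFamilyMatT F N (TcOfRecord F N) (chiFixed7 F N θ.ν) θ.εbg) θ.ρ8 θ.bV) θ.v₀)
    (hcoh : ∀ k, Fin.tail (θ.v₀ (k + 1)) = θ.v₀ k) (hadm : ∀ k i, 0 < θ.v₀ k i ∧ θ.v₀ k i ≤ γ')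
    (hN17 : NE4OnData (datumOfRecord₁₂ F N θ h) c ρ γ') :
    letI := θ.instVβ₁; letI := θ.instVβ₂; letI := θ.instιβ
    (∃ binf : ℝ, ∀ k,
        |beta0OfMerged (betaMerged F (mergedTermFamilyMatT F N (TcOfRecord F N) (chiFixed7 F N θ.ν) θ.εbg) θ.ρ8 θ.bV) θ.v₀ k - binf| ≤
          c / (1 - ρ) * ρ ^ k) ∧
      ScaleShiftRate (c + 2 * (c / (1 - ρ))) ρ γ' (fun k w =>
        betaMerged F (mergedTermFamilyMatT F N (TcOfRecord F N) (chiFixed7 F N θ.ν) θ.εbg) θ.ρ8 θ.bV k w -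
          beta0OfMerged (betaMerged F (mergedTermFamilyMatT F N (TcOfRecord F N) (chiFixed7 F N θ.ν) θ.εbg) θ.ρ8 θ.bV) θ.v₀ k) := by
  letI := θ.instVβ₁; letI := θ.instVβ₂; letI := θ.instιβ
  exact (atRecord_content_of_scaleShiftRate_merged hγ hγ' hρ0 hρ1 hlim hcoh hadm ((N17_datumOfRecord₁₂_iff_merged θ h hγ).mp hN17)).2

/-- **N17 AT THE STAGE-12 DATUM END TO END IN KERNEL CURRENCY** (companion 4 `N17_atAssemblyLine_of_kernelStepRate` at `βfun_datumOfRecord₁₂_eq_mergedT`):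
(UD) — (5.10)-decay of the record's OWN limiting polarisation kernels `polLimit F (k+1) (ℰT k v ·) θ.ρ8 θ.bV` of the `(TcOfRecord, chiFixed7)` family on the
boxes `]0,γ']` — ∧ their HISTORY-MATCHED STEP RATE `|Π_{k+2}(w; x) − Π_{k+1}(tail w; x)| ≤ C′ρ^k e^{−δ′|x|₁}`, `0 < γ' ≤ θ.γ`, `0 ≤ ρ < 1`, `Beta0LimitExists` at
coherent admissible `θ.v₀` ⟹ `NE4OnData D₁₂ (β′(C′,δ′)) ρ γ'` ∧ (AF-0r) for `beta0OfMerged βmT θ.v₀`.  (UD) PRINTED for Bałaban's kernels, a hypothesis here; the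
step rate NOT PRINTED — rows NE2 ∕ NE3 ∕ NE5 (N15 ∕ N16 ∕ N18) in the record's letters. [cite: Balaban1987RG1, (1.21)-(1.22) p.264 and (5.10) p.293] -/
theorem N17_datumOfRecord₁₂_of_kernelStepRate (θ : Stage12Params F N) (h : θ.Provisos₁₂ F N) {C δ C' δ' ρ γ' : ℝ} (hγ : γ' ≤ θ.γ)
    (hγ' : 0 < γ') (hρ0 : 0 ≤ ρ) (hρ1 : ρ < 1) (hδ : 0 < δ) (hδ' : 0 < δ')
    (hU : letI := θ.instVβ₁; letI := θ.instVβ₂; letI := θ.instιβ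
      ∀ k (v : Fin (k + 1) → ℝ), v ∈ Box γ' k →
        Decay510 (polLimit F (k + 1)
          (fun K => mergedTermFamilyMatT F N (TcOfRecord F N) (chiFixed7 F N θ.ν) θ.εbg k v K) θ.ρ8 θ.bV 0 1) C δ)
    (hS : letI := θ.instVβ₁; letI := θ.instVβ₂; letI := θ.instιβ
      ∀ k (w : Fin (k + 2) → ℝ), w ∈ Box γ' (k + 1) →
        Decay510 (subKernel
          (polLimit F (k + 1 + 1) (fun K => mergedTermFamilyMatT F N (TcOfRecord F N) (chiFixed7 F N θ.ν) θ.εbg (k + 1) w K) θ.ρ8 θ.bV)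
          (polLimit F (k + 1) (fun K => mergedTermFamilyMatT F N (TcOfRecord F N) (chiFixed7 F N θ.ν) θ.εbg k (Fin.tail w) K) θ.ρ8 θ.bV)
            0 1) (C' * ρ ^ k) δ')
    (hlim : letI := θ.instVβ₁; letI := θ.instVβ₂; letI := θ.instιβ
      Beta0LimitExists (betaMerged F (mergedTermFamilyMatT F N (TcOfRecord F N) (chiFixed7 F N θ.ν) θ.εbg) θ.ρ8 θ.bV) θ.v₀)
    (hcoh : ∀ k, Fin.tail (θ.v₀ (k + 1)) = θ.v₀ k) (hadm : ∀ k i, 0 < θ.v₀ k i ∧ θ.v₀ k i ≤ γ') :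
    NE4OnData (datumOfRecord₁₂ F N θ h) (betaPrime510 4 C' δ') ρ γ' ∧
      letI := θ.instVβ₁; letI := θ.instVβ₂; letI := θ.instιβ
      ∃ binf : ℝ, ∀ k,
        |beta0OfMerged (betaMerged F (mergedTermFamilyMatT F N (TcOfRecord F N) (chiFixed7 F N θ.ν) θ.εbg) θ.ρ8 θ.bV) θ.v₀ k - binf| ≤
          betaPrime510 4 C' δ' / (1 - ρ) * ρ ^ k := by
  letI := θ.instVβ₁; letI := θ.instVβ₂; letI := θ.instιβ
  exact N17_atAssemblyLine_of_kernelStepRate _ _ θ.ρ8 θ.bV (βfun_datumOfRecord₁₂_eq_mergedT θ h) hγ hγ' hρ0 hρ1 hδ hδ' hU hS hlim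
    hcoh hadm

/-- **THE CAP AT STAGE 12, as an `iff`** (companion 5 §20 at `βfun_datumOfRecord₁₂_eq_mergedT`): at admissible Stage-12 parameters, on a box LARGER than the record
box (`θ.γ < γ'`) the datum satisfies `NE4OnData D₁₂ c ρ γ'` IFF `βmT` satisfies NE4 on the record box ∧ is uniformly `cρ^k`-close on the record box to the next
one-loop number ∧ the one-loop numbers of record are geometrically Cauchy — the crux text takes `γ' ≤ θ.γ`. [cite: Balaban1987RG1, (1.22) p.264 («defined on the interval [0, γ]»)] -/
theorem N17_datumOfRecord₁₂_iff_of_lt (θ : Stage12Params F N) (h : θ.Provisos₁₂ F N) (hθ : θ.Admissible F N) {c ρ γ' : ℝ} (hlt : θ.γ < γ') :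
    NE4OnData (datumOfRecord₁₂ F N θ h) c ρ γ' ↔
      letI := θ.instVβ₁; letI := θ.instVβ₂; letI := θ.instιβ
      ScaleShiftRate c ρ θ.γ (betaMerged F (mergedTermFamilyMatT F N (TcOfRecord F N) (chiFixed7 F N θ.ν) θ.εbg) θ.ρ8 θ.bV) ∧
        (∀ k (v : Fin (k + 1) → ℝ), v ∈ Box θ.γ k →
          |beta0OfMerged (betaMerged F (mergedTermFamilyMatT F N (TcOfRecord F N) (chiFixed7 F N θ.ν) θ.εbg) θ.ρ8 θ.bV) θ.v₀ (k + 1) -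
              betaMerged F (mergedTermFamilyMatT F N (TcOfRecord F N) (chiFixed7 F N θ.ν) θ.εbg) θ.ρ8 θ.bV k v| ≤ c * ρ ^ k) ∧
        (∀ k, |beta0OfMerged (betaMerged F (mergedTermFamilyMatT F N (TcOfRecord F N) (chiFixed7 F N θ.ν) θ.εbg) θ.ρ8 θ.bV) θ.v₀ (k + 1) -
            beta0OfMerged (betaMerged F (mergedTermFamilyMatT F N (TcOfRecord F N) (chiFixed7 F N θ.ν) θ.εbg) θ.ρ8 θ.bV) θ.v₀ k| ≤
          c * ρ ^ k) := by
  letI := θ.instVβ₁; letI := θ.instVβ₂; letI := θ.instιβ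
  have h0 : 0 < θ.γ := hθ.toStage9.gamma_pos
  rw [ne4OnData_iff, βfun_datumOfRecord₁₂_eq_mergedT]
  exact scaleShiftRate_betaOfMerged_iff_of_lt (h0.trans hlt) hlt

/-! ## §44 N17 AT THE RECORD PREDICATE `IsRecordOfRecord₁₂C F N D w` — ∀-forms over admissible θ WITH `Provisos₁₂` (charted, β-version certified; NOT vacuous) -/

/-- **N17 AT A STAGE-12 RECORD `(D, w)`.**  If at EVERY admissible Stage-12 parameter with its provisos whose datum is `D` and whose record box contains the
world's window the continuous-version merged β `βmT` satisfies `ScaleShiftRate cN ρ w.γ`, then `NE4OnData D cN ρ w.γ` — the chart clause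
(`Admissible.toStage9.chart`), the β-version proviso (`Provisos₁₂.hasContTransportAlong`), the box side `w.γ ≤ θ.γ` and its positivity being CLAUSES of
`IsRecordOfRecord₁₂C`.  Hypothesis displayed, not asserted. [cite: Balaban1987RG1, (1.20)-(1.22) p.264; Balaban1989LargeFieldII, Thm 1 p.355] -/
theorem N17_of_isRecordOfRecord₁₂C {D : Datum F N} {w : WorldP} (h : IsRecordOfRecord₁₂C F N D w) {cN ρ : ℝ}
    (hin : ∀ (θ : Stage12Params F N) (hP : θ.Provisos₁₂ F N), θ.Admissible F N → D = datumOfRecord₁₂ F N θ hP → w.γ ≤ θ.γ →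
      letI := θ.instVβ₁; letI := θ.instVβ₂; letI := θ.instιβ
      ScaleShiftRate cN ρ w.γ (betaMerged F (mergedTermFamilyMatT F N (TcOfRecord F N) (chiFixed7 F N θ.ν) θ.εbg) θ.ρ8 θ.bV)) :
    NE4OnData D cN ρ w.γ := by
  obtain ⟨θ, hP, hθ, hD, -, ⟨-, hγle⟩, -, -⟩ := h
  have hm := hin θ hP hθ hD hγle
  subst hD
  exact (N17_datumOfRecord₁₂_iff_merged θ hP hγle).mpr hm

/-- **AT A STAGE-12 RECORD THE θ-KEYED BINDER IS EQUIVALENT TO N17** (new at ₁₂; kernel): `NE4OnData D cN ρ w.γ` holds IFF the `βmT` rate `ScaleShiftRate cN ρ w.γ`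
holds at EVERY admissible Stage-12 presentation `(θ, hP)` of `D` with `w.γ ≤ θ.γ` — N17 reads `D.βfun` only, and at each presentation `D.βfun` IS that θ's assembly
line on the box `]0, w.γ] ⊆ ]0, θ.γ]`; so §44's ∀-form loses nothing. [cite: Balaban1987RG1, (1.20)-(1.22) p.264; Balaban1989LargeFieldII, Thm 1 p.355] -/
theorem N17_iff_forall_of_isRecordOfRecord₁₂C {D : Datum F N} {w : WorldP} (h : IsRecordOfRecord₁₂C F N D w) (cN ρ : ℝ) :
    NE4OnData D cN ρ w.γ ↔
      ∀ (θ : Stage12Params F N) (hP : θ.Provisos₁₂ F N), θ.Admissible F N → D = datumOfRecord₁₂ F N θ hP → w.γ ≤ θ.γ →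
        letI := θ.instVβ₁; letI := θ.instVβ₂; letI := θ.instιβ
        ScaleShiftRate cN ρ w.γ (betaMerged F (mergedTermFamilyMatT F N (TcOfRecord F N) (chiFixed7 F N θ.ν) θ.εbg) θ.ρ8 θ.bV) := by
  refine ⟨fun hN θ hP _ hD hle => ?_, N17_of_isRecordOfRecord₁₂C h⟩
  subst hD
  exact (N17_datumOfRecord₁₂_iff_merged θ hP hle).mp hN

/-- **N17 AT A STAGE-12 RECORD BY THE SPLIT ROAD**: (AF-0r) for `beta0OfMerged βmT θ.v₀` (constant `c₀ ≥ 0`; N15's currency) ∧ the merged remainder's rate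
(constant `c₁`; N16 ∕ N18) on the world's window, asked of every admissible witness with provisos, `0 ≤ ρ ≤ 1` ⟹ `NE4OnData D (2c₀ + c₁) ρ w.γ`.
[cite: Balaban1987RG1, (2.12)-(2.14) p.268] -/
theorem N17_of_isRecordOfRecord₁₂C_rates {D : Datum F N} {w : WorldP} (h : IsRecordOfRecord₁₂C F N D w) {c₀ c₁ ρ : ℝ}
    (hρ0 : 0 ≤ ρ) (hρ1 : ρ ≤ 1) (hc₀ : 0 ≤ c₀)
    (hin : ∀ (θ : Stage12Params F N) (hP : θ.Provisos₁₂ F N), θ.Admissible F N → D = datumOfRecord₁₂ F N θ hP → w.γ ≤ θ.γ →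
      letI := θ.instVβ₁; letI := θ.instVβ₂; letI := θ.instιβ
      ∃ binf : ℝ,
        (∀ k, |beta0OfMerged (betaMerged F (mergedTermFamilyMatT F N (TcOfRecord F N) (chiFixed7 F N θ.ν) θ.εbg) θ.ρ8 θ.bV) θ.v₀ k -
            binf| ≤ c₀ * ρ ^ k) ∧
        ScaleShiftRate c₁ ρ w.γ fun k v =>
          betaMerged F (mergedTermFamilyMatT F N (TcOfRecord F N) (chiFixed7 F N θ.ν) θ.εbg) θ.ρ8 θ.bV k v -
            beta0OfMerged (betaMerged F (mergedTermFamilyMatT F N (TcOfRecord F N) (chiFixed7 F N θ.ν) θ.εbg) θ.ρ8 θ.bV) θ.v₀ k) :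
    NE4OnData D (2 * c₀ + c₁) ρ w.γ := by
  obtain ⟨θ, hP, hθ, hD, -, ⟨-, hγle⟩, -, -⟩ := h
  obtain ⟨binf, hconv, hrem⟩ := hin θ hP hθ hD hγle
  subst hD
  exact N17_datumOfRecord₁₂_of_rates θ hP hγle hρ0 hρ1 hc₀ hconv hrem

/-- **N17 AT A STAGE-12 RECORD IN KERNEL CURRENCY — the content form.**  (UD) ((5.10)-decay, some `C`, `δ > 0` per witness) ∧ the HISTORY-MATCHED STEP RATE
`|Π_{k+2}(w; x) − Π_{k+1}(tail w; x)| ≤ C′ρ^k e^{−δ′|x|₁}` (fixed `C′`, `δ′ > 0`) of the record's OWN limiting polarisation kernels `Node00.polLimit` of the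
`(TcOfRecord, chiFixed7)` merged term family, read through the (charted) `(θ.ρ8, θ.bV)`, on the world's window, asked of every admissible Stage-12 witness
with provisos ⟹ `NE4OnData D (β′(C′,δ′)) ρ w.γ` (companion 4 `scaleShiftRate_betaMerged_of_kernelStepRate`).  (UD) PRINTED for Bałaban's kernels, the step
rate NOT (rows NE2 ∕ NE3 ∕ NE5 = N15 ∕ N16 ∕ N18 in the record's letters). [cite: Balaban1987RG1, (1.21)-(1.22) p.264 and (5.10) p.293] -/
theorem N17_of_isRecordOfRecord₁₂C_kernelStepRate {D : Datum F N} {w : WorldP} (h : IsRecordOfRecord₁₂C F N D w) {C' δ' ρ : ℝ}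
    (hδ' : 0 < δ')
    (hin : ∀ (θ : Stage12Params F N) (hP : θ.Provisos₁₂ F N), θ.Admissible F N → D = datumOfRecord₁₂ F N θ hP → w.γ ≤ θ.γ →
      letI := θ.instVβ₁; letI := θ.instVβ₂; letI := θ.instιβ
      (∃ C δ : ℝ, 0 < δ ∧ ∀ k (v : Fin (k + 1) → ℝ), v ∈ Box w.γ k →
        Decay510 (polLimit F (k + 1)
          (fun K => mergedTermFamilyMatT F N (TcOfRecord F N) (chiFixed7 F N θ.ν) θ.εbg k v K) θ.ρ8 θ.bV 0 1) C δ) ∧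
      (∀ k (u : Fin (k + 2) → ℝ), u ∈ Box w.γ (k + 1) →
        Decay510 (subKernel
          (polLimit F (k + 1 + 1) (fun K => mergedTermFamilyMatT F N (TcOfRecord F N) (chiFixed7 F N θ.ν) θ.εbg (k + 1) u K) θ.ρ8 θ.bV)
          (polLimit F (k + 1) (fun K => mergedTermFamilyMatT F N (TcOfRecord F N) (chiFixed7 F N θ.ν) θ.εbg k (Fin.tail u) K) θ.ρ8 θ.bV)
            0 1) (C' * ρ ^ k) δ')) :
    NE4OnData D (betaPrime510 4 C' δ') ρ w.γ := by
  obtain ⟨θ, hP, hθ, hD, -, ⟨-, hγle⟩, -, -⟩ := h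
  obtain ⟨⟨C, δ, hδ, hU⟩, hS⟩ := hin θ hP hθ hD hγle
  subst hD
  letI := θ.instVβ₁; letI := θ.instVβ₂; letI := θ.instιβ
  exact (N17_datumOfRecord₁₂_iff_merged θ hP hγle).mpr
    (scaleShiftRate_betaMerged_of_kernelStepRate F (mergedTermFamilyMatT F N (TcOfRecord F N) (chiFixed7 F N θ.ν) θ.εbg) θ.ρ8 θ.bV
      hδ hδ' hU hS)

/-- **NODE U2's INPUT TRIPLE AT A STAGE-12 RECORD** (the N17 → N27 edge's input): N17 ∧ the history moduli OF `βmT` on the world's window, asked of every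
admissible witness with provisos, ∧ the β-free fading-memory clause ⟹ `U2Inputs D cN C ρ w.γ Λ`. [cite: Balaban1987RG1, §5 p.298] -/
theorem u2Inputs_of_isRecordOfRecord₁₂C {D : Datum F N} {w : WorldP} (h : IsRecordOfRecord₁₂C F N D w) {cN C ρ : ℝ}
    {Λ : ℕ → ℕ → ℝ} (hF : FadingMemory C ρ Λ)
    (hin : ∀ (θ : Stage12Params F N) (hP : θ.Provisos₁₂ F N), θ.Admissible F N → D = datumOfRecord₁₂ F N θ hP → w.γ ≤ θ.γ →
      letI := θ.instVβ₁; letI := θ.instVβ₂; letI := θ.instιβ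
      ScaleShiftRate cN ρ w.γ (betaMerged F (mergedTermFamilyMatT F N (TcOfRecord F N) (chiFixed7 F N θ.ν) θ.εbg) θ.ρ8 θ.bV) ∧
        HistLipschitz Λ w.γ (betaMerged F (mergedTermFamilyMatT F N (TcOfRecord F N) (chiFixed7 F N θ.ν) θ.εbg) θ.ρ8 θ.bV)) :
    U2Inputs D cN C ρ w.γ Λ := by
  obtain ⟨θ, hP, hθ, hD, -, ⟨-, hγle⟩, -, -⟩ := h
  obtain ⟨hm, hL⟩ := hin θ hP hθ hD hγle
  subst hD
  exact (u2Inputs_datumOfRecord₁₂_iff θ hP hγle).mpr ⟨hm, hL, hF⟩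

/-- **`2 ≤ N`: N17 AT A ₁₂C RECORD IS AN η-RATE STATEMENT ABOUT THE CONTINUOUS-VERSION MERGED β THROUGH A GENUINE CHART, AT A WITNESS CERTIFYING THE
β-VERSION PROVISO** (kernel): from `IsRecordOfRecord₁₂C F N D w` and `NE4OnData D c ρ w.γ` one obtains an admissible Stage-12 witness θ with provisos,
`θ.ρ8 ≠ 0` (`Admissible.toStage9.chart` + `IsChartOfRecord.rho8_ne_zero`), `θ.toStage8Params.HasContTransportAlong` (`Provisos₁₂.hasContTransportAlong`),
`w.γ ≤ θ.γ`, `D` its datum, AND `ScaleShiftRate c ρ w.γ βmT`. [cite: Balaban1987RG1, (0.13) p.254 and (1.20)-(1.22) p.264] -/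
theorem exists_chart_scaleShiftRate_of_N17₁₂ {D : Datum F N} {w : WorldP} (h : IsRecordOfRecord₁₂C F N D w) (hN : 2 ≤ N) {c ρ : ℝ}
    (hN17 : NE4OnData D c ρ w.γ) :
    ∃ (θ : Stage12Params F N) (hP : θ.Provisos₁₂ F N), θ.Admissible F N ∧ (letI := θ.instVβ₁; letI := θ.instVβ₂; θ.ρ8) ≠ 0 ∧
      θ.toStage8Params.HasContTransportAlong ∧ w.γ ≤ θ.γ ∧ D = datumOfRecord₁₂ F N θ hP ∧
      letI := θ.instVβ₁; letI := θ.instVβ₂; letI := θ.instιβ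
      ScaleShiftRate c ρ w.γ (betaMerged F (mergedTermFamilyMatT F N (TcOfRecord F N) (chiFixed7 F N θ.ν) θ.εbg) θ.ρ8 θ.bV) := by
  obtain ⟨θ, hP, hθ, hD, -, ⟨-, hγle⟩, -, -⟩ := h
  refine ⟨θ, hP, hθ, hθ.toStage9.chart.2.rho8_ne_zero hθ.toStage9.chart.1 hN, hP.hasContTransportAlong, hγle, hD, ?_⟩
  subst hD
  exact (N17_datumOfRecord₁₂_iff_merged θ hP hγle).mp hN17

/-- **WHAT N17 DELIVERS AT A STAGE-12 RECORD: (AF-0r) FOR THE RECORD's ONE-LOOP NUMBERS** (companion 4 `af0r_of_N17_atRecord`): `NE4OnData D c ρ w.γ` with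
`ρ < 1`, and — asked of every admissible witness with provisos realising `D` — `Beta0LimitExists βmT θ.v₀` at COHERENT reference histories with entries in
`]0, w.γ]` ⟹ some such witness θ with `∃ β⁰_∞, |beta0OfMerged βmT θ.v₀ k − β⁰_∞| ≤ (c∕(1−ρ))ρ^k` — the `hconv` input of NODE O ∕ K2′'s consumers, SUPPLIED by
the node at the record (β⁰-side hypotheses displayed, not asserted; `0 < w.γ` is the record's clause). [cite: Balaban1987RG1, (2.12)-(2.14) p.268] -/
theorem af0r_of_N17_isRecordOfRecord₁₂C {D : Datum F N} {w : WorldP} (h : IsRecordOfRecord₁₂C F N D w) {c ρ : ℝ} (hρ1 : ρ < 1)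
    (hN17 : NE4OnData D c ρ w.γ)
    (hin : ∀ (θ : Stage12Params F N) (hP : θ.Provisos₁₂ F N), θ.Admissible F N → D = datumOfRecord₁₂ F N θ hP → w.γ ≤ θ.γ →
      (letI := θ.instVβ₁; letI := θ.instVβ₂; letI := θ.instιβ
        Beta0LimitExists (betaMerged F (mergedTermFamilyMatT F N (TcOfRecord F N) (chiFixed7 F N θ.ν) θ.εbg) θ.ρ8 θ.bV) θ.v₀) ∧
      (∀ k, Fin.tail (θ.v₀ (k + 1)) = θ.v₀ k) ∧ ∀ k i, 0 < θ.v₀ k i ∧ θ.v₀ k i ≤ w.γ) :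
    ∃ (θ : Stage12Params F N) (hP : θ.Provisos₁₂ F N), θ.Admissible F N ∧ D = datumOfRecord₁₂ F N θ hP ∧
      letI := θ.instVβ₁; letI := θ.instVβ₂; letI := θ.instιβ
      ∃ binf : ℝ, ∀ k,
        |beta0OfMerged (betaMerged F (mergedTermFamilyMatT F N (TcOfRecord F N) (chiFixed7 F N θ.ν) θ.εbg) θ.ρ8 θ.bV) θ.v₀ k - binf| ≤
          c / (1 - ρ) * ρ ^ k := by
  obtain ⟨θ, hP, hθ, hD, -, ⟨hγ0, hγle⟩, -, -⟩ := h
  obtain ⟨hlim, hcoh, hadm⟩ := hin θ hP hθ hD hγle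
  refine ⟨θ, hP, hθ, hD, ?_⟩
  subst hD
  letI := θ.instVβ₁; letI := θ.instVβ₂; letI := θ.instιβ
  exact af0r_of_N17_atRecord _ (βfun_datumOfRecord₁₂_eq_mergedT θ hP) hγle hγ0 hρ1 hlim hcoh hadm hN17

/-- **EVERY ₁₂C RECORD HAS def-T's STAGE-5 SHADOW WITH THE SAME β-FUNCTIONS, AT WHICH N17 IS THE SAME STATEMENT** [bookkeeping]
(`Record12.exists_isRecordOfRecord₅C_of_isRecordOfRecord₁₂C`): the repaired pins and the tower datum concern `dens ∕ R ∕ Sect2Form`, not `βfun`.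
[cite: Balaban1989LargeFieldII, Thm 1 p.355 (bookkeeping)] -/
theorem exists_shadow₅_N17_iff₁₂ {D : Datum F N} {w : WorldP} (h : IsRecordOfRecord₁₂C F N D w) :
    ∃ D₅ : Datum F N, IsRecordOfRecord₅C F N D₅ w ∧ D₅.βfun = D.βfun ∧
      ∀ (c ρ γ' : ℝ), NE4OnData D c ρ γ' ↔ NE4OnData D₅ c ρ γ' := by
  obtain ⟨D₅, h5, -, -, hβ, -⟩ := exists_isRecordOfRecord₅C_of_isRecordOfRecord₁₂C h
  exact ⟨D₅, h5, hβ, fun c ρ γ' => by rw [ne4OnData_iff, ne4OnData_iff, hβ]⟩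

/-- **THE SHAPE IN WHICH THE ₁₂C BINDERS HAVE CONTENT** (def-T's `exists_world_isRecordOfRecord₁₂C`, new at ₁₂): every admissible Stage-12 parameter WITH ITS
PROVISOS is a ₁₂C record at some world `w` with ANY prescribed window `0 < γw ≤ θ.γ`, and at that record N17 on the world's window IS the `βmT` rate
`ScaleShiftRate c ρ γw` — so a K0′-style inhabitant `(θ, h, hθ)` makes §44's ∀-forms bite on a genuine box.  Inhabitation itself (K0′) is NOT claimed.
[cite: Balaban1989LargeFieldII, Thm 1 + (0.1) pp.355-356; Balaban1987RG1, (1.20)-(1.22) p.264] -/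
theorem exists_isRecordOfRecord₁₂C_N17_iff (θ : Stage12Params F N) (h : θ.Provisos₁₂ F N) (hθ : θ.Admissible F N) {γw : ℝ}
    (hγw : 0 < γw ∧ γw ≤ θ.γ) (c ρ : ℝ) :
    ∃ w : WorldP, IsRecordOfRecord₁₂C F N (datumOfRecord₁₂ F N θ h) w ∧ w.γ = γw ∧
      (NE4OnData (datumOfRecord₁₂ F N θ h) c ρ w.γ ↔
        letI := θ.instVβ₁; letI := θ.instVβ₂; letI := θ.instιβ
        ScaleShiftRate c ρ γw (betaMerged F (mergedTermFamilyMatT F N (TcOfRecord F N) (chiFixed7 F N θ.ν) θ.εbg) θ.ρ8 θ.bV)) := by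
  obtain ⟨w, hw, hγ⟩ := exists_world_isRecordOfRecord₁₂C F N θ h hθ hγw
  refine ⟨w, hw, hγ, ?_⟩
  rw [hγ]
  exact N17_datumOfRecord₁₂_iff_merged θ h hγw.2

/-! ## §45 THE LINK TO CLUSTER K4's STUB `YMDAG.UVSplit.S_N17 RRec` AT STAGE 12 -/

/-- **(W2) CLOSER — `S_N17 RRec` FOR EVERY RATE RECORD READING THE STAGE-12 RECORD WITH THE RATE** (kernel): if every bundle `R` of record for `(F, D, g₀, os)`
comes with an admissible Stage-12 witness θ WITH ITS PROVISOS realising `D`, with `R.u3.γ ≤ θ.γ`, at which `βmT` has the η-rate at `R.u3`'s dependent letters,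
then `S_N17 RRec` — the one-application closer for an `RRec` home keyed over `Stage12Params` (RR-2's `IsDatumOfRecord₁₂C.params` shape; admissibility carries the
chart clause). [cite: Balaban1987RG1, (1.20)-(1.22) p.264] -/
theorem s_N17_of_stage12_slot (RRec : RateRecordPred N)
    (hslot : ∀ (F : T4Family) (D : Datum F N) (g₀ : ℕ → ℝ) (os : List (ULoop F)) (R : RateCarriers N), RRec F D g₀ os R →
      ∃ (θ : Stage12Params F N) (hP : θ.Provisos₁₂ F N), θ.Admissible F N ∧ D = datumOfRecord₁₂ F N θ hP ∧ R.u3.γ ≤ θ.γ ∧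
        letI := θ.instVβ₁; letI := θ.instVβ₂; letI := θ.instιβ
        ScaleShiftRate (R.u3.cr * R.u3.C₅ * R.u3.θ) R.u3.ρ R.u3.γ
          (betaMerged F (mergedTermFamilyMatT F N (TcOfRecord F N) (chiFixed7 F N θ.ν) θ.εbg) θ.ρ8 θ.bV)) :
    S_N17 RRec := by
  intro F D g₀ os R hR
  obtain ⟨θ, hP, -, hD, hγ, hm⟩ := hslot F D g₀ os R hR
  subst hD
  exact (n17At_datumOfRecord₁₂_iff_merged θ hP R.u3 hγ).mpr hm

/-- **(W2) CLOSER FOR AN `RRec` HOME KEYED TO `IsRecordOfRecord₁₂C`**: if every bundle `R` of record for `(F, D, g₀, os)` comes with a world `w` making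
`(D, w)` a Stage-12 record whose window IS node U3's box (`R.u3.γ = w.γ`), and the `βmT` rate at `R.u3`'s letters is supplied in §44's ∀-form, then `S_N17 RRec`.
Stage-free alternatives (not restated): `YMDAG.N17.s_N17_of_D4_N18` (U3 road), `YMDAG.N17.n17At_of_transferModel` (IN n15 ∕ n16). [cite: Balaban1987RG1, (1.20)-(1.22) p.264] -/
theorem s_N17_of_rec₁₂C (RRec : RateRecordPred N)
    (hhome : ∀ (F : T4Family) (D : Datum F N) (g₀ : ℕ → ℝ) (os : List (ULoop F)) (R : RateCarriers N), RRec F D g₀ os R →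
      ∃ w : WorldP, IsRecordOfRecord₁₂C F N D w ∧ R.u3.γ = w.γ)
    (hin : ∀ (F : T4Family) (D : Datum F N) (g₀ : ℕ → ℝ) (os : List (ULoop F)) (R : RateCarriers N), RRec F D g₀ os R →
      ∀ (θ : Stage12Params F N) (hP : θ.Provisos₁₂ F N), θ.Admissible F N → D = datumOfRecord₁₂ F N θ hP → R.u3.γ ≤ θ.γ →
        letI := θ.instVβ₁; letI := θ.instVβ₂; letI := θ.instιβ
        ScaleShiftRate (R.u3.cr * R.u3.C₅ * R.u3.θ) R.u3.ρ R.u3.γ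
          (betaMerged F (mergedTermFamilyMatT F N (TcOfRecord F N) (chiFixed7 F N θ.ν) θ.εbg) θ.ρ8 θ.bV)) :
    S_N17 RRec := by
  intro F D g₀ os R hR
  obtain ⟨w, hw, hγ⟩ := hhome F D g₀ os R hR
  show NE4OnData D _ _ _
  rw [hγ]
  exact N17_of_isRecordOfRecord₁₂C hw fun θ hP hθ hD hle => hγ ▸ hin F D g₀ os R hR θ hP hθ hD (hγ.le.trans hle)

/-- **THE (D4) READ-OUT BINDERS AT A STAGE-12 DATUM ARE STATEMENTS ABOUT THE CONTINUOUS-VERSION β OF RECORD** [bookkeeping]: module 2's `ReadOutAt` at the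
Stage-12 datum = at the Stage-10 datum of `θ.toStage9Params` (`βfun` identity of §43, `Iff.rfl`); there `ReadOutAt (datumOfRecord₁₂ F N θ h) u` asks the two runs'
output functionals to REPRESENT `betaOfRecord₁₀ F N θ.toStage9Params` on the `u.γ`-boxes, so companion 6's stage-free glue `YMDAG.N17.s_N17_of_D4_N18` closes
`S_N17` from `S_D4 ∧ S_N18` for any `RRec` home over ₁₂C. [cite: Balaban1987RG1, (1.20)-(1.22) p.264] -/
theorem readOutAt_datumOfRecord₁₂_iff_stage10 (θ : Stage12Params F N) (h : θ.Provisos₁₂ F N) (u : U3Carriers) :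
    YMDAG.UVSplit.ReadOutAt (datumOfRecord₁₂ F N θ h) u ↔
      YMDAG.UVSplit.ReadOutAt (datumOfRecord₁₀ F N θ.toStage9Params h.base) u := Iff.rfl

end Summit.QuantumFields.YangMills.Theorems.BalabanUVNodesN17

end
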